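import Literature.AlgebraicGeometry.HodgeTheory.ProjectiveCastelnuovoMumfordRegularity
import Literature.AlgebraicGeometry.HodgeTheory.ProjectiveSubquotientHilbertFunction
import Literature.Algebra.Homology.LaurentCechSubquotientPresentation
import Literature.Algebra.Homology.LaurentCechSubquotientHyperplaneSection
import HarnessLib

/-!
# Castelnuovo–Mumford regularity (Mumford's Castelnuovo lemma) for subquotients `N' ⧸ N`

Mumford, *Lectures on Curves on an Algebraic Surface*, Lecture 14 (pp. 99–101): a coherent sheaf `𝓕`
on `ℙ^r` is `m`-regular if `H^i(𝓕(m - i)) = 0` for all `i > 0`; **Castelnuovo's lemma**: then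
(a) `H⁰(𝓕(n)) ⊗ H⁰(𝒪(1)) → H⁰(𝓕(n + 1))` is onto for `n ≥ m`, and (b) `H^i(𝓕(n)) = 0` for `i > 0`,
`n + i ≥ m` — in particular `𝓕` is `m'`-regular for all `m' ≥ m`.

`ProjectiveCastelnuovoMumfordRegularity` proves this for the graded QUOTIENTS `M = F_e ⧸ K`
(`LaurentCech.quot`). Mumford applies it to IDEAL SHEAVES `𝓘_Z ⊂ 𝒪_X`, which in the tree are
SUBQUOTIENTS `(N' ⧸ N)~` (`LaurentCech.subquot e N N' h n`, multiplication maps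
`LaurentCechSubquotientHyperplaneSection.subquotMul`). This file transports Castelnuovo's lemma along
the presentation `N' ⧸ N ≅ F_{e'} ⧸ φ⁻¹N` of `LaurentCechSubquotientPresentation`:

* `LaurentCech.quotSMul_comp_cokernel_map_inclusion` — the comparison map
  `Č_d(F_{e'} ⧸ K') ⟶ Č_d(N' ⧸ N)` commutes with multiplication by homogeneous polynomials
  (`quotSMul` vs `subquotMul`): it is a map of graded `P`-modules;
* **`LaurentCech.exists_quot_iso_subquot_natural`** — for graded `N ≤ N'` (Noetherian base) a
  presentation `F_{e'} ⧸ K'` with isomorphisms `Φ_d : Č_d(F_{e'} ⧸ K') ≅ Č_d(N' ⧸ N)` for all `d`,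
  NATURAL with respect to all multiplication maps `g·`;
* `LaurentCech.isZero_homology_subquot_of_regular`, `LaurentCech.isZero_homology_subquot_of_regular'`,
  `LaurentCech.regular_subquot_of_le` — **Castelnuovo (b) for `N' ⧸ N`**;
* **`LaurentCech.top_le_iSup_range_homologyMap_subquotMul_of_regular`** — **Castelnuovo (a) for
  `N' ⧸ N`**: `H⁰(Č_{n+1}(N' ⧸ N))` is spanned by `P₁ · H⁰(Č_n(N' ⧸ N))` for `n ≥ m`;
* `LaurentCech.exists_regular_subquot` — every `(N' ⧸ N)~` is `m`-regular for some `m` (Serre).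

(`k` an infinite field and `r ≥ 1` for (a), (b), as in the quotient file.)

## References

* [Mumford1966CurvesSurface] D. Mumford, *Lectures on Curves on an Algebraic Surface*, Annals of
  Math. Studies 59, Princeton 1966, Lecture 14 (pp. 99–101).
* [Eisenbud2005] D. Eisenbud, *The Geometry of Syzygies*, GTM 229, Springer 2005, Cor. 4.18 (p. 103).
* [Hartshorne1977] R. Hartshorne, *Algebraic Geometry*, III Thm. 5.2 (p. 228), III Ex. 5.10 (p. 231).
-/

noncomputable section

open CategoryTheory CategoryTheory.Limits

universe u

namespace Literature.Algebra.Homology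

namespace LaurentCech

open OrderedCech TopCohomology

/-! ### The comparison map is `P`-linear; natural presentations -/

section Natural

variable {A : Type u} [CommRing A] {r : ℕ} {J J' : Type} {e : J → ℤ} {e' : J' → ℤ}
  [Fintype J'] [DecidableEq J'] {φ : (J' → P A r) →ₗ[P A r] (J → P A r)}

/-- **The comparison `Č_d(F_{e'} ⧸ K') ⟶ Č_d(N' ⧸ N)` commutes with multiplication by a homogeneous
`g ∈ P_c`** (`quotSMul` on the source, `subquotMul` on the target): `φ_L` is `L`-linear
(`smulMap_comp_cechMapOf`). [cite: Hartshorne1977, III Thm. 5.1 (proof, p. 225)]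
[cite: Mumford1966CurvesSurface, Lecture 14 (p. 99)] -/
theorem quotSMul_comp_cokernel_map_inclusion (hφ : IsDegZero e e' φ)
    (K' : Submodule (P A r) (J' → P A r)) {N N' : Submodule (P A r) (J → P A r)} (h : N ≤ N')
    (hK : K'.map φ ≤ N) (hN' : (⊤ : Submodule (P A r) (J' → P A r)).map φ ≤ N') {c : ℤ}
    (g : P A r) (hg : toL A r g ∈ Ldeg A r c) (d d₁ : ℤ) (hd : d + c = d₁) :
    quotSMul e' K' g hg d d₁ hd ≫ cokernel.map (inclusion e' K' ⊤ le_top d₁) (inclusion e N N' h d₁)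
        (cechMapOf hφ K' N hK d₁) (cechMapOf hφ ⊤ N' hN' d₁)
        (inclusion_comp_cechMapOf hφ K' ⊤ le_top N N' h hK hN' d₁) =
      cokernel.map (inclusion e' K' ⊤ le_top d) (inclusion e N N' h d)
        (cechMapOf hφ K' N hK d) (cechMapOf hφ ⊤ N' hN' d)
        (inclusion_comp_cechMapOf hφ K' ⊤ le_top N N' h hK hN' d) ≫
        subquotMul e N N' h g hg d d₁ hd := by
  apply coequalizer.hom_ext
  rw [π_comp_quotSMul_assoc, cokernel.π_desc, cokernel.π_desc_assoc, subquotMul, Category.assoc,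
    cokernel.π_desc, ← Category.assoc, ← Category.assoc, smulMap_comp_cechMapOf]

/-- **A presentation of `N' ⧸ N` with Čech complexes isomorphic NATURALLY in the multiplication
maps**: for graded `N ≤ N' ⊆ F_e` over a Noetherian ring there are `e' : Fin n → ℤ`, a graded
`K' ⊆ F_{e'}` and isomorphisms `Φ_d : Č_d(F_{e'} ⧸ K') ≅ Č_d(N' ⧸ N)` (all `d`) with
`(g·) ≫ Φ_{d+c} = Φ_d ≫ (g·)` for every homogeneous `g ∈ P_c`.
[cite: Hartshorne1977, II Cor. 5.18 (p. 121)] [cite: Hartshorne1977, III Thm. 5.1 (proof, p. 225)] -/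
theorem exists_quot_iso_subquot_natural [Finite J] [IsNoetherianRing A]
    {N N' : Submodule (P A r) (J → P A r)} (hNg : IsGraded e N) (hN'g : IsGraded e N') (h : N ≤ N') :
    ∃ (n : ℕ) (e' : Fin n → ℤ) (K' : Submodule (P A r) (Fin n → P A r))
      (Φ : ∀ d : ℤ, quot e' K' d ≅ subquot e N N' h d), IsGraded e' K' ∧
      ∀ (c : ℤ) (g : P A r) (hg : toL A r g ∈ Ldeg A r c) (d d₁ : ℤ) (hd : d + c = d₁),
        quotSMul e' K' g hg d d₁ hd ≫ (Φ d₁).hom = (Φ d).hom ≫ subquotMul e N N' h g hg d d₁ hd := by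
  obtain ⟨n, e', φ, hφ, hφN'⟩ := exists_presentation e hN'g
  have hK : (N.comap φ).map φ ≤ N := Submodule.map_comap_le φ N
  have hN' : (⊤ : Submodule (P A r) (Fin n → P A r)).map φ ≤ N' := by
    rw [Submodule.map_top, hφN']
  have hsurj : LinearMap.range φ ⊔ N = N' := by rw [hφN']; exact sup_eq_left.2 h
  haveI := fun d => isIso_cokernel_map_inclusion hφ (N.comap φ) h hNg hK hN' (fun u hu => hu) hsurj d
  exact ⟨n, e', N.comap φ, fun d => asIso (cokernel.map (inclusion e' (N.comap φ) ⊤ le_top d)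
      (inclusion e N N' h d) (cechMapOf hφ (N.comap φ) N hK d) (cechMapOf hφ ⊤ N' hN' d)
      (inclusion_comp_cechMapOf hφ (N.comap φ) ⊤ le_top N N' h hK hN' d)),
    hφ.isGraded_comap hNg, fun c g hg d d₁ hd =>
      quotSMul_comp_cokernel_map_inclusion hφ (N.comap φ) h hK hN' g hg d d₁ hd⟩

end Natural

/-! ### Existence of a regularity bound -/

section Existence

variable {A : Type u} [CommRing A] [IsNoetherianRing A] {r : ℕ} {J : Type} [Fintype J] (e : J → ℤ)

/-- **Every `(N' ⧸ N)~` is `m`-regular for some `m`** (`A` Noetherian, `J` finite, `N ≤ N'` graded):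
Serre's vanishing for subquotients gives `d₀` with `H^i(Č_d(N' ⧸ N)) = 0` for `i ≥ 1`, `d ≥ d₀`; take
`m = d₀ + r`. [cite: Hartshorne1977, III Thm. 5.2 (b) (p. 228)]
[cite: Mumford1966CurvesSurface, Lecture 14 (p. 99)] -/
theorem exists_regular_subquot {N N' : Submodule (P A r) (J → P A r)} (hN : IsGraded e N)
    (hN' : IsGraded e N') (h : N ≤ N') :
    ∃ m : ℤ, ∀ i : ℤ, 1 ≤ i → IsZero ((subquot e N N' h (m - i)).homology i) := by
  obtain ⟨d₀, hd₀⟩ := exists_forall_isZero_homology_subquot e hN hN' h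
  refine ⟨d₀ + r, fun i hi => ?_⟩
  by_cases hir : i ≤ r
  · exact hd₀ _ (by omega) i hi
  · exact isZero_homology_subquot_of_lt e N N' h _ i (by omega)

end Existence

/-! ### Castelnuovo's lemma for subquotients -/

section Castelnuovo

variable {k : Type u} [Field k] [Infinite k] {r : ℕ} {J : Type} [Fintype J] (e : J → ℤ)

/-- **Castelnuovo (b) for `N' ⧸ N`**: if `H^i(Č_{m-i}(N' ⧸ N)) = 0` for all `i ≥ 1` then
`H^i(Č_n(N' ⧸ N)) = 0` for all `i ≥ 1`, `n ≥ m - i` (`k` infinite, `N ≤ N'` graded).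
[cite: Mumford1966CurvesSurface, Lecture 14 (pp. 99–100)] [cite: Eisenbud2005, Cor. 4.18 (p. 103)] -/
theorem isZero_homology_subquot_of_regular {N N' : Submodule (P k r) (J → P k r)}
    (hN : IsGraded e N) (hN' : IsGraded e N') (h : N ≤ N') (m : ℤ)
    (hm : ∀ i : ℤ, 1 ≤ i → IsZero ((subquot e N N' h (m - i)).homology i)) :
    ∀ i : ℤ, 1 ≤ i → ∀ n : ℤ, m - i ≤ n → IsZero ((subquot e N N' h n).homology i) := by
  obtain ⟨n', e', K', hK', -, hzero⟩ := exists_quot_finrank_homology_eq_subquot hN hN' h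
  intro i hi n hn
  exact (hzero n i).1 (isZero_homology_quot_of_regular e' hK' m
    (fun j hj => (hzero _ j).2 (hm j hj)) i hi n hn)

/-- (b) in Mumford's indexing: `H^i(Č_n(N' ⧸ N)) = 0` whenever `i > 0` and `n + i ≥ m`.
[cite: Mumford1966CurvesSurface, Lecture 14 (p. 99)] -/
theorem isZero_homology_subquot_of_regular' {N N' : Submodule (P k r) (J → P k r)}
    (hN : IsGraded e N) (hN' : IsGraded e N') (h : N ≤ N') (m : ℤ)
    (hm : ∀ i : ℤ, 1 ≤ i → IsZero ((subquot e N N' h (m - i)).homology i))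
    {i n : ℤ} (hi : 0 < i) (hn : m ≤ n + i) : IsZero ((subquot e N N' h n).homology i) :=
  isZero_homology_subquot_of_regular e hN hN' h m hm i hi n (by omega)

/-- **`m`-regular ⇒ `m'`-regular for `m' ≥ m`**, for subquotients.
[cite: Mumford1966CurvesSurface, Lecture 14 (p. 99)] -/
theorem regular_subquot_of_le {N N' : Submodule (P k r) (J → P k r)}
    (hN : IsGraded e N) (hN' : IsGraded e N') (h : N ≤ N') {m m' : ℤ} (hmm' : m ≤ m')
    (hm : ∀ i : ℤ, 1 ≤ i → IsZero ((subquot e N N' h (m - i)).homology i)) :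
    ∀ i : ℤ, 1 ≤ i → IsZero ((subquot e N N' h (m' - i)).homology i) :=
  fun i hi => isZero_homology_subquot_of_regular e hN hN' h m hm i hi _ (by omega)

/-- **Castelnuovo (a) for `N' ⧸ N`: for an `m`-regular `(N' ⧸ N)~` and `n ≥ m`,
`H⁰(Č_{n+1}(N' ⧸ N))` is spanned by the images of the multiplication maps
`g· : H⁰(Č_n(N' ⧸ N)) → H⁰(Č_{n+1}(N' ⧸ N))`, `g ∈ P₁`** (`k` infinite, `r ≥ 1`, `N ≤ N'` graded) —
transported from `F_{e'} ⧸ φ⁻¹N` along the natural isomorphisms of `exists_quot_iso_subquot_natural`.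
[cite: Mumford1966CurvesSurface, Lecture 14 (pp. 99–100)] [cite: Eisenbud2005, Cor. 4.18 (p. 103)] -/
theorem top_le_iSup_range_homologyMap_subquotMul_of_regular (hr : 1 ≤ r)
    {N N' : Submodule (P k r) (J → P k r)} (hN : IsGraded e N) (hN' : IsGraded e N') (h : N ≤ N')
    (m : ℤ) (hm : ∀ i : ℤ, 1 ≤ i → IsZero ((subquot e N N' h (m - i)).homology i)) {n : ℤ}
    (hn : m ≤ n) :
    (⊤ : Submodule k ((subquot e N N' h (n + 1)).homology 0)) ≤
      ⨆ (g : P k r) (hg : toL k r g ∈ Ldeg k r 1), LinearMap.range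
        (HomologicalComplex.homologyMap (subquotMul e N N' h g hg n (n + 1) rfl) 0).hom := by
  obtain ⟨n', e', K', Φ, hK', hnat⟩ := exists_quot_iso_subquot_natural hN hN' h
  -- the cohomology isomorphisms
  let H : ∀ d : ℤ, (quot e' K' d).homology 0 ≅ (subquot e N N' h d).homology 0 := fun d =>
    (HomologicalComplex.homologyFunctor (ModuleCat.{u} k) (ComplexShape.up ℤ) 0).mapIso (Φ d)
  have hm' : ∀ i : ℤ, 1 ≤ i → IsZero ((quot e' K' (m - i)).homology i) := fun i hi =>
    (hm i hi).of_iso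
      ((HomologicalComplex.homologyFunctor (ModuleCat.{u} k) (ComplexShape.up ℤ) i).mapIso (Φ _))
  have hq := top_le_iSup_range_homologyMap_quotSMul_of_regular e' hr hK' m hm' hn
  intro x _
  -- pull `x` back to the presentation, decompose there, push forward
  have hy : (H (n + 1)).inv.hom x ∈ ⨆ (g : P k r) (hg : toL k r g ∈ Ldeg k r 1), LinearMap.range
      (HomologicalComplex.homologyMap (quotSMul e' K' g hg n (n + 1) rfl) 0).hom := hq Submodule.mem_top
  have hx : x = (H (n + 1)).hom.hom ((H (n + 1)).inv.hom x) := by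
    rw [← ModuleCat.comp_apply, Iso.inv_hom_id, ModuleCat.id_apply]
  rw [hx]
  refine Submodule.iSup_induction _ (motive := fun y => (H (n + 1)).hom.hom y ∈ _) hy
    (fun g y hyg => ?_) (by rw [map_zero]; exact Submodule.zero_mem _)
    (fun y z hy' hz' => by rw [map_add]; exact Submodule.add_mem _ hy' hz')
  refine Submodule.iSup_induction _ (motive := fun y => (H (n + 1)).hom.hom y ∈ _) hyg
    (fun hg y hyg' => ?_) (by rw [map_zero]; exact Submodule.zero_mem _)
    (fun y z hy' hz' => by rw [map_add]; exact Submodule.add_mem _ hy' hz')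
  obtain ⟨w, rfl⟩ := hyg'
  refine Submodule.mem_iSup_of_mem g (Submodule.mem_iSup_of_mem hg ⟨(H n).hom.hom w, ?_⟩)
  change (HomologicalComplex.homologyMap (Φ n).hom 0 ≫
      HomologicalComplex.homologyMap (subquotMul e N N' h g hg n (n + 1) rfl) 0).hom w =
    (HomologicalComplex.homologyMap (quotSMul e' K' g hg n (n + 1) rfl) 0 ≫
      HomologicalComplex.homologyMap (Φ (n + 1)).hom 0).hom w
  rw [← HomologicalComplex.homologyMap_comp, ← HomologicalComplex.homologyMap_comp, hnat]

end Castelnuovo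

end LaurentCech

end Literature.Algebra.Homology

end
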